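import Summits.CriticalPhenomena.Ising3DConformalLimit.Theorems.IsingEuclidUpgradeR4NonGaussianDefs
import Literature.Probability.LatticeModels.SourcedCurrentLaw
import Literature.Probability.LatticeModels.CurrentExploration
import Literature.Probability.LatticeModels.WeightedCurrentsDictionary
import HarnessLib

/-!
# Crux `WindowForcesU4` (stmt-CriticalPhenomena-5505), line `backbone-thinning-window` (reshape r1) —
# stub `stub_backboneDensityDictionary`: current sums ↦ probabilities of the single sourced current

Routes `LatticeSDPCertificates` r3 / `CoerciveSharpness` r5 of `Ising3DConformalLimit`; `--supports` file of the
registered stub `stub_backboneDensityDictionary` (P2, "CURRENT SUMS ↦ PROBABILITIES") of the lead's skeleton.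

Write `Z[S] = Σ_{∂m = S} w_{β_c}(m)` for the current sums of the free box graph of `Λ_n ⊂ ℤ³` at `β_c(3)`
(`ecurrentSum (fun _ => criticalBeta 3) S` in `ℝ≥0∞`, `currentSum` in `ℝ`), `P^{ab} = currentLaw _ (criticalBeta 3)
({a} ∆ {b})` for the single current with sources `{a, b}` and `Γ(m) = (Current.explore rk m {b} a).vis` for the
visited set of Aizenman's walk (any bond ranking `rk`).  The stub converts

* the un-normalised one-point LOWER bound `κ·Z[au]Z[ub] ≤ (Σ_{∂m=ab} w(m)𝟙[u ∈ Γ(m)])·Z[∅]` into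
  `κ·G_n(a,u)G_n(u,b)/G_n(a,b) ≤ P^{ab}[u ∈ Γ]` (`threePointRatio`), and
* the un-normalised two-point UPPER bound `(Σ_{∂m=ab} w(m)𝟙[u,v ∈ Γ(m)])·Z[∅]² ≤ κ·(Z[au]Z[uv]Z[vb] + Z[av]Z[vu]Z[ub])`
  into `P^{ab}[u,v ∈ Γ] ≤ κ·twoStep_n(a,b,u,v)/G_n(a,b)`,

by the two dictionaries `P^A[S] = (Σ_{∂m = A} w(m)𝟙[m ∈ S])/Z[A]` (Duminil-Copin 2016, Def. 3.2; `currentLaw_real_apply`)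
and `G_n(x,y) = Z[{x}∆{y}]/Z[∅]` for `x, y ∈ Λ_n` (random-current representation, Duminil-Copin 2016, eq. (2.2);
`isingTwoPoint_free_box_eq_boxGraph` + `isingTwoPoint_free_eq_currentSum_div_holds`), the cast `ℝ≥0∞ → ℝ`
(`toReal_ecurrentSum`, all sums finite, `Z[∅] > 0`) and the degenerate normaliser `Z[ab] = 0` handled by `x/0 = 0` on
both sides.  §1 is stated for an arbitrary finite graph, `β ≥ 0` and an arbitrary decidable event in place of
`{u ∈ Γ}` / `{u, v ∈ Γ}` (nothing about the exploration is used); §2 specialises to the box.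

Theorem-only file (no definitions, no named facts).  References: H. Duminil-Copin, *Random currents expansion of
the Ising model*, arXiv:1607.06933, Def. 3.2 and §2.1 eq. (2.2) [DuminilCopin2016].
-/

noncomputable section

open MeasureTheory Finset
open Literature.Probability.LatticeModels Literature.Probability.Percolation
open scoped symmDiff ENNReal
open Summit.CriticalPhenomena.Ising3DConformalLimit.Cruxes.IsingEuclidUpgradeR4NonGaussian.FreeCovarianceDeltaDichotomy
  (boxG threePointRatio twoStep)

namespace Summit.CriticalPhenomena.Ising3DConformalLimit.LatticeSDPCertificatesWindowForcesU4.BackboneDensityDictionaryProof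

/-! ## §1. Any finite graph: `P^A[p] = (Σ_{∂m=A} w(m)𝟙[p m])/Z[A]` and the two divisions -/

section Finite

variable {V : Type*} [Fintype V] [DecidableEq V] (G : SimpleGraph V) [DecidableRel G.Adj]

/-- The weighted indicator sum `Σ_{∂m = A} w_K(m) 𝟙[p m]` is at most `Z_K[A]`, hence finite (`K ≥ 0`). [folklore] -/
private theorem tsum_weight_indicator_ne_top {K : G.edgeFinset → ℝ} (hK : ∀ e, 0 ≤ K e) (A : Finset V)
    (p : Current G → Prop) [DecidablePred p] :
    (∑' m : Current G, (if m.sources = A then m.eweight K else 0) * (if p m then 1 else 0)) ≠ ∞ := by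
  refine ne_top_of_le_ne_top (ecurrentSum_ne_top hK A) ?_
  unfold ecurrentSum
  refine ENNReal.tsum_le_tsum fun m => mul_le_of_le_one_right' ?_
  split_ifs
  · exact le_rfl
  · exact zero_le_one

-- adapted from Theorems/FKParityRobustnessIndependentStrandsJoinR1SinglePairTree.lean (`spt_currentLaw_real_eq_tsum_div`)
/-- **`P^A_{G,β}` of a decidable event as a quotient of current sums** (Duminil-Copin 2016, Def. 3.2,
`P^A[m] = w_β(m)𝟙[∂m = A]/Z[A]`): `P^A[{m | p m}] = (Σ_{∂m = A} w_β(m) 𝟙[p m]).toReal / Z[A]`, the numerator written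
as the `ℝ≥0∞` series of the skeleton. [cite: DuminilCopin2016, Def. 3.2] -/
private theorem currentLaw_real_setOf_eq {β : ℝ} (hβ : 0 ≤ β) (A : Finset V) (p : Current G → Prop)
    [DecidablePred p] :
    (currentLaw G β A).real {m | p m} =
      (∑' m : Current G, (if m.sources = A then m.eweight (fun _ : G.edgeFinset => β) else 0) *
          (if p m then 1 else 0)).toReal / currentSum G β A := by
  have hK : ∀ e : G.edgeFinset, 0 ≤ (fun _ : G.edgeFinset => β) e := fun _ => hβ
  have hne : ∀ m : Current G, (if m.sources = A then m.eweight (fun _ : G.edgeFinset => β) else 0) *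
      (if p m then (1 : ℝ≥0∞) else 0) ≠ ∞ := fun m =>
    ENNReal.mul_ne_top (by split_ifs; exacts [Current.eweight_ne_top _ m, ENNReal.zero_ne_top])
      (by split_ifs; exacts [ENNReal.one_ne_top, ENNReal.zero_ne_top])
  rw [currentLaw_real_apply G hβ A, ENNReal.tsum_toReal_eq hne, ← tsum_div_const]
  refine tsum_congr fun m => ?_
  by_cases hm : p m
  · rw [if_pos (show m ∈ {m : Current G | p m} from hm), if_pos hm, mul_one, currentProb]
    split_ifs
    · rw [Current.toReal_eweight hK, Current.weight_eq_wweight]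
    · rw [ENNReal.toReal_zero]
  · rw [if_neg (show m ∉ {m : Current G | p m} from hm), if_neg hm, mul_zero, ENNReal.toReal_zero, zero_div]

/-- Real arithmetic of the one-point division: `0 < z`, `0 ≤ A`, `κ·(pq) ≤ N·z` give
`κ·((p/z)(q/z)/(A/z)) ≤ N/A` (both sides vanish for `A = 0`). [folklore] -/
private theorem arith_one {κ p q N z A : ℝ} (hz : 0 < z) (hA : 0 ≤ A) (h : κ * (p * q) ≤ N * z) :
    κ * (p / z * (q / z) / (A / z)) ≤ N / A := by
  rcases hA.eq_or_lt with rfl | hA'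
  · simp
  · have hz' : z ≠ 0 := hz.ne'
    have hA'' : A ≠ 0 := hA'.ne'
    calc κ * (p / z * (q / z) / (A / z)) = κ * (p * q) / (z * A) := by field_simp
      _ ≤ N * z / (z * A) := div_le_div_of_nonneg_right h (by positivity)
      _ = N / A := by rw [mul_comm z A, mul_div_mul_right _ _ hz']

/-- Real arithmetic of the two-point division: `0 < z`, `0 ≤ A`, `N·z·z ≤ κ·(p₁p₂p₃ + q₁q₂q₃)` give
`N/A ≤ κ·((p₁/z)(p₂/z)(p₃/z) + (q₁/z)(q₂/z)(q₃/z))/(A/z)` (both sides vanish for `A = 0`). [folklore] -/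
private theorem arith_two {κ N z A p₁ p₂ p₃ q₁ q₂ q₃ : ℝ} (hz : 0 < z) (hA : 0 ≤ A)
    (h : N * z * z ≤ κ * (p₁ * p₂ * p₃ + q₁ * q₂ * q₃)) :
    N / A ≤ κ * (p₁ / z * (p₂ / z) * (p₃ / z) + q₁ / z * (q₂ / z) * (q₃ / z)) / (A / z) := by
  rcases hA.eq_or_lt with rfl | hA'
  · simp
  · have hz' : z ≠ 0 := hz.ne'
    have hA'' : A ≠ 0 := hA'.ne'
    calc N / A = N * z * z / (z * z * A) := by field_simp
      _ ≤ κ * (p₁ * p₂ * p₃ + q₁ * q₂ * q₃) / (z * z * A) := div_le_div_of_nonneg_right h (by positivity)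
      _ = κ * (p₁ / z * (p₂ / z) * (p₃ / z) + q₁ / z * (q₂ / z) * (q₃ / z)) / (A / z) := by field_simp

/-- **One-point dictionary** (any finite graph, `β ≥ 0`, `κ ≥ 0`, any decidable event `p`):
`κ·Z[S₁]Z[S₂] ≤ (Σ_{∂m=A} w(m)𝟙[p m])·Z[∅]` in `ℝ≥0∞` gives
`κ·(Z[S₁]/Z[∅])(Z[S₂]/Z[∅])/(Z[A]/Z[∅]) ≤ P^A[p]` (`Z[A] = 0`: both sides are `0`). [cite: DuminilCopin2016, Def. 3.2] -/
private theorem dictionary_one {β : ℝ} (hβ : 0 ≤ β) (A : Finset V) (p : Current G → Prop) [DecidablePred p]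
    {κ : ℝ} (hκ : 0 ≤ κ) (S₁ S₂ : Finset V)
    (h : ENNReal.ofReal κ *
        (ecurrentSum (fun _ : G.edgeFinset => β) S₁ * ecurrentSum (fun _ : G.edgeFinset => β) S₂) ≤
      (∑' m : Current G, (if m.sources = A then m.eweight (fun _ : G.edgeFinset => β) else 0) *
          (if p m then 1 else 0)) * ecurrentSum (fun _ : G.edgeFinset => β) ∅) :
    κ * (currentSum G β S₁ / currentSum G β ∅ * (currentSum G β S₂ / currentSum G β ∅) /
        (currentSum G β A / currentSum G β ∅)) ≤ (currentLaw G β A).real {m | p m} := by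
  have hK : ∀ e : G.edgeFinset, 0 ≤ (fun _ : G.edgeFinset => β) e := fun _ => hβ
  have hZ : ∀ S : Finset V, (ecurrentSum (fun _ : G.edgeFinset => β) S).toReal = currentSum G β S :=
    fun S => by rw [toReal_ecurrentSum hK S, currentSum_eq_wcurrentSum]
  rw [currentLaw_real_setOf_eq G hβ A p]
  refine arith_one (currentSum_empty_pos' G β) (currentSum_nonneg G hβ A) ?_
  simpa only [ENNReal.toReal_mul, ENNReal.toReal_ofReal hκ, hZ] using
    ENNReal.toReal_mono (ENNReal.mul_ne_top (tsum_weight_indicator_ne_top G hK A p) (ecurrentSum_ne_top hK ∅)) h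

/-- **Two-point dictionary** (any finite graph, `β ≥ 0`, `κ ≥ 0`, any decidable event `p`):
`(Σ_{∂m=A} w(m)𝟙[p m])·Z[∅]² ≤ κ·(Z[S₁]Z[S₂]Z[S₃] + Z[T₁]Z[T₂]Z[T₃])` in `ℝ≥0∞` gives
`P^A[p] ≤ κ·((Z[S₁]/Z[∅])(Z[S₂]/Z[∅])(Z[S₃]/Z[∅]) + (Z[T₁]/Z[∅])(Z[T₂]/Z[∅])(Z[T₃]/Z[∅]))/(Z[A]/Z[∅])`
(`Z[A] = 0`: both sides are `0`). [cite: DuminilCopin2016, Def. 3.2] -/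
private theorem dictionary_two {β : ℝ} (hβ : 0 ≤ β) (A : Finset V) (p : Current G → Prop) [DecidablePred p]
    {κ : ℝ} (hκ : 0 ≤ κ) (S₁ S₂ S₃ T₁ T₂ T₃ : Finset V)
    (h : (∑' m : Current G, (if m.sources = A then m.eweight (fun _ : G.edgeFinset => β) else 0) *
          (if p m then 1 else 0)) * ecurrentSum (fun _ : G.edgeFinset => β) ∅ *
          ecurrentSum (fun _ : G.edgeFinset => β) ∅ ≤
      ENNReal.ofReal κ *
        (ecurrentSum (fun _ : G.edgeFinset => β) S₁ * ecurrentSum (fun _ : G.edgeFinset => β) S₂ *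
            ecurrentSum (fun _ : G.edgeFinset => β) S₃ +
          ecurrentSum (fun _ : G.edgeFinset => β) T₁ * ecurrentSum (fun _ : G.edgeFinset => β) T₂ *
            ecurrentSum (fun _ : G.edgeFinset => β) T₃)) :
    (currentLaw G β A).real {m | p m} ≤
      κ * (currentSum G β S₁ / currentSum G β ∅ * (currentSum G β S₂ / currentSum G β ∅) *
            (currentSum G β S₃ / currentSum G β ∅) +
          currentSum G β T₁ / currentSum G β ∅ * (currentSum G β T₂ / currentSum G β ∅) *
            (currentSum G β T₃ / currentSum G β ∅)) / (currentSum G β A / currentSum G β ∅) := by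
  have hK : ∀ e : G.edgeFinset, 0 ≤ (fun _ : G.edgeFinset => β) e := fun _ => hβ
  have hZ : ∀ S : Finset V, (ecurrentSum (fun _ : G.edgeFinset => β) S).toReal = currentSum G β S :=
    fun S => by rw [toReal_ecurrentSum hK S, currentSum_eq_wcurrentSum]
  have hfin : ∀ S : Finset V, ecurrentSum (fun _ : G.edgeFinset => β) S ≠ ∞ := fun S => ecurrentSum_ne_top hK S
  have h3 : ∀ S T U : Finset V, ecurrentSum (fun _ : G.edgeFinset => β) S *
      ecurrentSum (fun _ : G.edgeFinset => β) T * ecurrentSum (fun _ : G.edgeFinset => β) U ≠ ∞ :=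
    fun S T U => ENNReal.mul_ne_top (ENNReal.mul_ne_top (hfin S) (hfin T)) (hfin U)
  rw [currentLaw_real_setOf_eq G hβ A p]
  refine arith_two (currentSum_empty_pos' G β) (currentSum_nonneg G hβ A) ?_
  simpa only [ENNReal.toReal_mul, ENNReal.toReal_add (h3 S₁ S₂ S₃) (h3 T₁ T₂ T₃), ENNReal.toReal_ofReal hκ,
    hZ] using ENNReal.toReal_mono (ENNReal.mul_ne_top ENNReal.ofReal_ne_top
      (ENNReal.add_ne_top.2 ⟨h3 S₁ S₂ S₃, h3 T₁ T₂ T₃⟩)) h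

end Finite

/-! ## §2. The free box `Λ_n ⊂ ℤ³` at `β_c(3)` -/

/-- The free box two-point function at `β_c(3)` as a ratio of current sums of the free box graph:
`G_n(x,y) = Z[{x}∆{y}]/Z[∅]` for `x, y ∈ Λ_n` (random-current representation). [cite: DuminilCopin2016, §2.1, eq. (2.2)] -/
private theorem boxG_eq_div (n : ℕ) (x y : BoxVertex 3 n) (hx : (x : Site 3) ∈ box 3 n)
    (hy : (y : Site 3) ∈ box 3 n) :
    boxG n x y = currentSum (freeBoxGraph 3 n) (criticalBeta 3) ({x} ∆ {y}) /
      currentSum (freeBoxGraph 3 n) (criticalBeta 3) ∅ := by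
  unfold boxG
  rw [isingTwoPoint_free_box_eq_boxGraph 3 n _ x y hx hy,
    isingTwoPoint_free_eq_currentSum_div_holds (freeBoxGraph 3 n) (criticalBeta 3) x y]

/-- **Registered stub `stub_backboneDensityDictionary`** (P2 of line `backbone-thinning-window`, crux
stmt-CriticalPhenomena-5505; CURRENT SUMS ↦ PROBABILITIES). For box vertices `a ≠ b`, `u`, `v` of `Λ_n`, `κ ≥ 0` and any
bond ranking `rk` (backbone `Γ(m) = (Current.explore rk m {b} a).vis`): the un-normalised one-point LOWER bound
`κ·Z[au]Z[ub] ≤ (Σ_{∂m=ab} w(m)𝟙[u ∈ Γ])·Z[∅]` gives `κ·G_n(a,u)G_n(u,b)/G_n(a,b) ≤ P^{ab}_{Λ_n}[u ∈ Γ]`, and the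
un-normalised two-point UPPER bound `(Σ w 𝟙[u,v ∈ Γ])·Z[∅]² ≤ κ·(Z[au]Z[uv]Z[vb] + Z[av]Z[vu]Z[ub])` gives
`P^{ab}_{Λ_n}[u,v ∈ Γ] ≤ κ·twoStep_n(a,b,u,v)/G_n(a,b)` (`P^{ab}{m} = w(m)/Z[ab]`, `G_n(x,y) = Z[xy]/Z[∅]`; degenerate
normalisers by `x/0 = 0`). The hypothesis `a ≠ b` is not used. [cite: DuminilCopin2016, Def. 3.2] -/
theorem stub_backboneDensityDictionary :
    ∀ (n : ℕ) (rk : (freeBoxGraph 3 n).edgeFinset → ℕ) (a b u v : BoxVertex 3 n) (κ : ℝ), 0 ≤ κ →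
      (a : Site 3) ∈ box 3 n → (b : Site 3) ∈ box 3 n → (u : Site 3) ∈ box 3 n → (v : Site 3) ∈ box 3 n → a ≠ b →
      (ENNReal.ofReal κ *
            (ecurrentSum (fun _ : (freeBoxGraph 3 n).edgeFinset => criticalBeta 3) ({a} ∆ {u}) *
              ecurrentSum (fun _ : (freeBoxGraph 3 n).edgeFinset => criticalBeta 3) ({u} ∆ {b})) ≤
          (∑' m : Current (freeBoxGraph 3 n),
              (if m.sources = {a} ∆ {b} then m.eweight (fun _ => criticalBeta 3) else 0) *
                (if u ∈ (Current.explore rk m {b} a).vis then 1 else 0)) *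
            ecurrentSum (fun _ : (freeBoxGraph 3 n).edgeFinset => criticalBeta 3) ∅ →
        κ * threePointRatio n (a : Site 3) (b : Site 3) (u : Site 3) ≤
          (currentLaw (freeBoxGraph 3 n) (criticalBeta 3) ({a} ∆ {b})).real {m | u ∈ (Current.explore rk m {b} a).vis}) ∧
      ((∑' m : Current (freeBoxGraph 3 n),
            (if m.sources = {a} ∆ {b} then m.eweight (fun _ => criticalBeta 3) else 0) *
              (if u ∈ (Current.explore rk m {b} a).vis ∧ v ∈ (Current.explore rk m {b} a).vis then 1 else 0)) *
            ecurrentSum (fun _ : (freeBoxGraph 3 n).edgeFinset => criticalBeta 3) ∅ * ecurrentSum (fun _ : (freeBoxGraph 3 n).edgeFinset => criticalBeta 3) ∅ ≤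
          ENNReal.ofReal κ *
            (ecurrentSum (fun _ : (freeBoxGraph 3 n).edgeFinset => criticalBeta 3) ({a} ∆ {u}) * ecurrentSum (fun _ : (freeBoxGraph 3 n).edgeFinset => criticalBeta 3) ({u} ∆ {v}) * ecurrentSum (fun _ : (freeBoxGraph 3 n).edgeFinset => criticalBeta 3) ({v} ∆ {b}) +
              ecurrentSum (fun _ : (freeBoxGraph 3 n).edgeFinset => criticalBeta 3) ({a} ∆ {v}) * ecurrentSum (fun _ : (freeBoxGraph 3 n).edgeFinset => criticalBeta 3) ({v} ∆ {u}) * ecurrentSum (fun _ : (freeBoxGraph 3 n).edgeFinset => criticalBeta 3) ({u} ∆ {b})) →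
        (currentLaw (freeBoxGraph 3 n) (criticalBeta 3) ({a} ∆ {b})).real
            {m | u ∈ (Current.explore rk m {b} a).vis ∧ v ∈ (Current.explore rk m {b} a).vis} ≤
          κ * twoStep n (a : Site 3) (b : Site 3) (u : Site 3) (v : Site 3) / boxG n (a : Site 3) (b : Site 3)) := by
  intro n rk a b u v κ hκ ha hb hu hv _
  have hβ : 0 ≤ criticalBeta 3 := criticalBeta_nonneg 3
  refine ⟨fun h => ?_, fun h => ?_⟩
  · rw [threePointRatio, boxG_eq_div n a u ha hu, boxG_eq_div n u b hu hb, boxG_eq_div n a b ha hb]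
    exact dictionary_one (freeBoxGraph 3 n) hβ _ _ hκ _ _ h
  · rw [twoStep, boxG_eq_div n a u ha hu, boxG_eq_div n u v hu hv, boxG_eq_div n v b hv hb,
      boxG_eq_div n a v ha hv, boxG_eq_div n v u hv hu, boxG_eq_div n u b hu hb, boxG_eq_div n a b ha hb]
    exact dictionary_two (freeBoxGraph 3 n) hβ _ _ hκ _ _ _ _ _ _ h

end Summit.CriticalPhenomena.Ising3DConformalLimit.LatticeSDPCertificatesWindowForcesU4.BackboneDensityDictionaryProof

end
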